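import Summits.ResolutionOfSingularities.ResolutionOfSingularities.Theorems.FrobeniusLadderFInjectiveMacaulayficationP2d4CTauRefChar2Fan
import Summits.ResolutionOfSingularities.ResolutionOfSingularities.Theorems.FrobeniusLadderFInjectiveMacaulayficationP2d4CChar2Germ
import Summits.ResolutionOfSingularities.ResolutionOfSingularities.Theorems.FrobeniusLadderFInjectiveMacaulayficationPointFixableOfCert
import Summits.ResolutionOfSingularities.ResolutionOfSingularities.Theorems.FrobeniusLadderFInjectiveMacaulayficationGermOfPointFixable
import Summits.ResolutionOfSingularities.ResolutionOfSingularities.Theorems.FrobeniusLadderFInjectiveMacaulayficationRegularBlowupModelDim2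
import Literature.AlgebraicGeometry.Resolution.AffineBlowupUnique
import Literature.AlgebraicGeometry.Resolution.AffineBlowupUniversal
import Literature.AlgebraicGeometry.Resolution.AffineBlowupIntegral
import Literature.AlgebraicGeometry.Resolution.BlowupsFlatBaseChange
import HarnessLib

/-!
# F4POS-2a (β): THE BLOWING UP OF P2d4C ALONG THE Σ_τ-REFINING MONOMIAL CENTRE `I_{A′}` IS FULL AT EVERY POINT — PINNED CENTRE, EXPLICIT MODEL
# (crux `FInjectiveMacaulayfication` stmt-ResolutionOfSingularities-15315, chain w45a; res-L1-w45a-plan-1 RULINGS R18.10/R18.12 «F4POS-2 = first F(4)-pos kernel row»;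
# seat res-L1-w45a-stub-2 g7; data `P2d4CTauRefChar2Fan` (cert baded671c2236547); consumer res-L1-w45a-stub-3 F4POS-2b)

[OURS · L1 W4.5a] Support file (`--supports stmt-ResolutionOfSingularities-15315 --as helper`); def-free, unconditional; replaces the role of NO printed item;
NOT a statement of the manuscript; AI-written (AI review is weaker than expert review).

SETTING. `X = Spec R̄`, `R̄ = k[x,y,u,t,z]/(f)`, `f = z² + x⁴z + y³ + u³ + t³`, `char k = 2` (specimen `FCentreE1RungZero`); `I_{A′} ⊂ R̄` the image of the 43-generator
monomial ideal of `P2d4CTauRefChar2Fan.A` (fan = star subdivisions `(1,1,1,1,1) → (1,2,2,2,2) → (1,2,2,2,3)`, REFINING `Σ_τ`, `τ = (x², y, u, t, z)`).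
Unlike the census rows `P2d4CChar2Germ.p2d4c_germ` / `p2d4c_bad_germ_row` (centre hidden behind `∃`; NOT re-proved here — they hold verbatim and a second proof
would be a duplicate), THIS file PINS the centre and the model, which is what F4POS-2b consumes (`Bl_{K𝒪_{S′}} S′ ≅ Bl_{τK} X`, `IsBlowup.comp`):
* §1 `affineBlowup_tauRef_fullCl_over` — every stalk of `affineBlowup I_{A′}` (the tree's `Proj R̄[I_{A′}t]`) over `V(I_{A′})` is FULL, in the frame's
  `Set.range ![f]` presentation (`CICertificates.ciCertificates` on the kernel-checked tables + `PointFixableOfCert.affineBlowup_fiClause_over_of_cert`);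
* §2 ★★ `affineBlowup_tauRef_fullCl` — **EVERY stalk of `affineBlowup I_{A′}` is FULL** (`k[X]/(f)` presentation; off `V(I_{A′}) = {0}` the blow-up is an
  isomorphism onto the regular locus: `FCentreE1RungZero.regular_off_vertex`, `IsBlowup.isIso_compl`); `support_idealSheaf_tauRef` — `supp Ĩ_{A′} = {0}`;
  ★★ `forall_isBlowup_tauRef_fullCl` — EVERY blowing up `π : X′ → X` along `Ĩ_{A′} := affineBlowup.idealSheaf I_{A′}` is FULL at every point (`IsBlowup.unique`).
HONESTY. This is the OUTPUT half of the F(4)-pos row in GLOBAL affine form with the centre pinned; the identification with `Bl_𝒦 S′` for the τ-floor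
`S′ = Bl_τ X` and the F-half's literal (local, universally-quantified-in-`S′`) shape are F4POS-2b (res-L1-w45a-stub-3), the INPUT legality of `S′` is F4POS-1
(p615290, p616615, p617159; CI charts res-L1-w45a-stub-1 (c)). Nothing of [claim: Hironaka2017] is used. [folklore glue; cite: Fedder1983, Thm. 1.12; StacksProject, Tag 0804;
GortzWedhorn2020, Prop. 13.91 and Prop. 13.92; CoxLittleSchenck2011, §2.3]
-/

-- single-problem summit: the doubled namespace component is forced
set_option linter.dupNamespace false

noncomputable section

open AlgebraicGeometry CategoryTheory Literature.AlgebraicGeometry.Resolution TopologicalSpace IsLocalRing MvPolynomial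

namespace Summit.ResolutionOfSingularities.ResolutionOfSingularities.Theorems.FInjectiveMacaulayfication.P2d4CTauRefBlowupFull

open Summit.ResolutionOfSingularities.ResolutionOfSingularities.Theorems.FInjectiveMacaulayfication
open SliceableCentre FCentreE1ChartWitness FCentreE1ChartPresentation FCentreE1RungZero

/-! ## §1 Over the centre, in the frame's presentation `k[X]/(Set.range ![f])` -/

set_option maxHeartbeats 800000 in
-- the frame's binder block is large; instantiation is by name
/-- **Every stalk of `affineBlowup I_{A′}` OVER `V(I_{A′})` is FULL** (frame presentation `k[X]/(Set.range Fs)`, `Fs = ![f]`): the road-B certificate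
(`CICertificates.ciCertificates` on `P2d4CTauRefChar2Fan`'s kernel-checked tables, `hon'` from `RoadBFrame.hon_of_kernelChecks`) fed to
`PointFixableOfCert.affineBlowup_fiClause_over_of_cert`. [folklore glue; cite: Fedder1983, Thm. 1.12; StacksProject, Tag 0804] -/
theorem affineBlowup_tauRef_fullCl_over (k : Type) [Field k] [CharP k 2] (Fs : Fin 1 → MvPolynomial (Fin 5) k)
    (hFs : Fs = ![X 4 ^ 2 + X 0 ^ 4 * X 4 + X 1 ^ 3 + X 2 ^ 3 + X 3 ^ 3]) :
    ∀ y : ↥(affineBlowup (Ideal.span ((fun e : Fin 5 →₀ ℕ => Ideal.Quotient.mk (Ideal.span (Set.range Fs)) (monomial e (1 : k))) ''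
        (P2d4CTauRefChar2Fan.A : Set (Fin 5 →₀ ℕ))))),
      Ideal.span ((fun e : Fin 5 →₀ ℕ => Ideal.Quotient.mk (Ideal.span (Set.range Fs)) (monomial e (1 : k))) ''
          (P2d4CTauRefChar2Fan.A : Set (Fin 5 →₀ ℕ))) ≤
        ((affineBlowup.π (Ideal.span ((fun e : Fin 5 →₀ ℕ => Ideal.Quotient.mk (Ideal.span (Set.range Fs)) (monomial e (1 : k))) ''
          (P2d4CTauRefChar2Fan.A : Set (Fin 5 →₀ ℕ))))).base y).asIdeal →
      FullCl 2 ((affineBlowup (Ideal.span ((fun e : Fin 5 →₀ ℕ => Ideal.Quotient.mk (Ideal.span (Set.range Fs)) (monomial e (1 : k))) ''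
        (P2d4CTauRefChar2Fan.A : Set (Fin 5 →₀ ℕ))))).presheaf.stalk y) := by
  classical
  haveI : Fact (Nat.Prime 2) := ⟨Nat.prime_two⟩
  subst hFs
  set f : MvPolynomial (Fin 5) k := X 4 ^ 2 + X 0 ^ 4 * X 4 + X 1 ^ 3 + X 2 ^ 3 + X 3 ^ 3 with hf
  have hr : Set.range (![f] : Fin 1 → MvPolynomial (Fin 5) k) = {f} := LevelTwoBlockTranslate.range_vec_one f
  have hfprime : (Ideal.span {f}).IsPrime := (Ideal.span_singleton_prime (prime_f k f hf).ne_zero).mpr (prime_f k f hf)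
  haveI hpr : (Ideal.span (Set.range (![f] : Fin 1 → MvPolynomial (Fin 5) k))).IsPrime := by rw [hr]; exact hfprime
  haveI : IsDomain (MvPolynomial (Fin 5) k ⧸ Ideal.span (Set.range (![f] : Fin 1 → MvPolynomial (Fin 5) k))) := Ideal.Quotient.isDomain _
  haveI : CharP (MvPolynomial (Fin 5) k ⧸ Ideal.span (Set.range (![f] : Fin 1 → MvPolynomial (Fin 5) k))) 2 :=
    charP_of_injective_algebraMap (algebraMap k _).injective 2
  have hXne : ∀ v : Fin 5, Ideal.Quotient.mk (Ideal.span (Set.range (![f] : Fin 1 → MvPolynomial (Fin 5) k))) (X v) ≠ 0 := by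
    intro v h0
    have hmem : (X v : MvPolynomial (Fin 5) k) ∈ Ideal.span (Set.range (![f] : Fin 1 → MvPolynomial (Fin 5) k)) :=
      Ideal.Quotient.eq_zero_iff_mem.mp h0
    rw [hr] at hmem
    by_cases hv : v = 1
    · subst hv
      refine mk_X_ne_zero_of_eval k f hfprime 1 (Pi.single 2 1) (by simp) ?_ (Ideal.Quotient.eq_zero_iff_mem.mpr hmem)
      rw [hf]; simp
    · refine mk_X_ne_zero_of_eval k f hfprime v (Pi.single 1 1) (Pi.single_eq_of_ne hv _) ?_ (Ideal.Quotient.eq_zero_iff_mem.mpr hmem)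
      rw [hf]; simp
  have hθF' : ∀ (c : Fin 13) (l : Fin 1), aeval (fun j : Fin 5 => ∏ i : Fin 5, (X i : MvPolynomial (Fin 5) k) ^ P2d4CTauRefChar2Fan.V c i j)
      ((![f] : Fin 1 → MvPolynomial (Fin 5) k) l) =
      monomial (P2d4CTauRefChar2Fan.d c l) (1 : k) *
        (fun c : Fin 13 => (![KLocCellKit.evalL k (P2d4CTauRefChar2Fan.G c)] : Fin 1 → MvPolynomial (Fin 5) k)) c l := by
    intro c l
    fin_cases l
    exact P2d4CTauRefChar2Fan.hθF₀ k c
  have hon := RoadBFrame.hon_of_kernelChecks 2 k 5 13 P2d4CTauRefChar2Fan.V P2d4CTauRefChar2Fan.G (P2d4CTauRefChar2Fan.hg0 k)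
    (P2d4CTauRefChar2Fan.hX k) P2d4CTauRefChar2Fan.CELLS P2d4CTauRefChar2Fan.hcheck P2d4CTauRefChar2Fan.hSS
  obtain ⟨hcovR, hv0, hon'⟩ := CICertificates.ciCertificates 2 k Finset.univ P2d4CTauRefChar2Fan.A P2d4CTauRefChar2Fan.hprim 13
    P2d4CTauRefChar2Fan.m (P2d4CTauRefChar2Fan.hcov k) P2d4CTauRefChar2Fan.V P2d4CTauRefChar2Fan.hV P2d4CTauRefChar2Fan.a
    P2d4CTauRefChar2Fan.haA P2d4CTauRefChar2Fan.hgen P2d4CTauRefChar2Fan.hge (![f] : Fin 1 → MvPolynomial (Fin 5) k) hpr hXne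
    (fun c : Fin 13 => (![KLocCellKit.evalL k (P2d4CTauRefChar2Fan.G c)] : Fin 1 → MvPolynomial (Fin 5) k)) P2d4CTauRefChar2Fan.d hθF'
    P2d4CTauRefChar2Fan.hunit hon (P2d4CTauRefChar2Fan.hv k _)
  intro y hy
  exact PointFixableOfCert.affineBlowup_fiClause_over_of_cert 2 _ _ 13 _ (P2d4CTauRefChar2Fan.hv k _) hcovR hv0 hon' y hy

/-! ## §2 ★★ Everywhere, in the presentation `k[X]/(f)`; the support; every blowing up -/

set_option maxHeartbeats 800000 in
-- presentation rewrite + one blow-up-is-iso transport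
/-- ★★ **THE BLOWING UP OF `X = V(z² + x⁴z + y³ + u³ + t³) ⊂ 𝔸⁵_k` (`char k = 2`) ALONG THE Σ_τ-REFINING MONOMIAL CENTRE `I_{A′}` IS FULL AT EVERY POINT**
(explicit model `affineBlowup I_{A′}`, centre PINNED as the image of `(x^e : e ∈ P2d4CTauRefChar2Fan.A)`): over the vertex by §1; elsewhere `X` is regular
(`FCentreE1RungZero.regular_off_vertex`) and the blow-up is a local isomorphism (`IsBlowup.isIso_compl`), so the stalk is regular, hence FULL.
[OURS · certificate instance; cite: Fedder1983, Thm. 1.12; StacksProject, Tag 0804; GortzWedhorn2020, Prop. 13.91] -/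
theorem affineBlowup_tauRef_fullCl (k : Type) [Field k] [CharP k 2] (f : MvPolynomial (Fin 5) k)
    (hf : f = X 4 ^ 2 + X 0 ^ 4 * X 4 + X 1 ^ 3 + X 2 ^ 3 + X 3 ^ 3) :
    ∀ y : ↥(affineBlowup (Ideal.span ((fun e : Fin 5 →₀ ℕ => Ideal.Quotient.mk (Ideal.span {f}) (monomial e (1 : k))) ''
        (P2d4CTauRefChar2Fan.A : Set (Fin 5 →₀ ℕ))))),
      FullCl 2 ((affineBlowup (Ideal.span ((fun e : Fin 5 →₀ ℕ => Ideal.Quotient.mk (Ideal.span {f}) (monomial e (1 : k))) ''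
        (P2d4CTauRefChar2Fan.A : Set (Fin 5 →₀ ℕ))))).presheaf.stalk y) := by
  classical
  haveI : Fact (Nat.Prime 2) := ⟨Nat.prime_two⟩
  subst hf
  -- §1 in the presentation `k[X]/(f)`
  have hover := affineBlowup_tauRef_fullCl_over k _ rfl
  rw [LevelTwoBlockTranslate.range_vec_one] at hover
  set f : MvPolynomial (Fin 5) k := X 4 ^ 2 + X 0 ^ 4 * X 4 + X 1 ^ 3 + X 2 ^ 3 + X 3 ^ 3 with hf
  haveI hfprime : (Ideal.span {f}).IsPrime := (Ideal.span_singleton_prime (prime_f k f hf).ne_zero).mpr (prime_f k f hf)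
  haveI : IsDomain (MvPolynomial (Fin 5) k ⧸ Ideal.span {f}) := Ideal.Quotient.isDomain _
  set I : Ideal (MvPolynomial (Fin 5) k ⧸ Ideal.span {f}) :=
    Ideal.span ((fun e : Fin 5 →₀ ℕ => Ideal.Quotient.mk (Ideal.span {f}) (monomial e (1 : k))) '' (P2d4CTauRefChar2Fan.A : Set (Fin 5 →₀ ℕ))) with hI
  intro y
  by_cases hy : I ≤ ((affineBlowup.π I).base y).asIdeal
  · exact hover y hy
  · -- off the vertex: `X` regular there and `π` an isomorphism over the complement of `V(I) = {vertex}`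
    have hvert : ¬ Ideal.span (Set.range fun j : Fin 5 => Ideal.Quotient.mk (Ideal.span {f}) (X j)) ≤ ((affineBlowup.π I).base y).asIdeal := by
      intro hle
      exact hy ((CICertificates.centre_le_iff (Ideal.span {f}) Finset.univ P2d4CTauRefChar2Fan.A P2d4CTauRefChar2Fan.hAJ
        P2d4CTauRefChar2Fan.hprim _).mpr fun j _ => hle (Ideal.subset_span ⟨j, rfl⟩))
    have hreg : (affineBlowup.π I).base y ∈ Scheme.regularLocus (Spec (.of (MvPolynomial (Fin 5) k ⧸ Ideal.span {f}))) :=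
      FermatCubicConeGerm.mem_regularLocus_Spec_of_isRegularLocalRing _ (regular_off_vertex k f hf _ hvert)
    have hsupp : (affineBlowup.π I).base y ∉ ((affineBlowup.idealSheaf I).support : Set (Spec (.of (MvPolynomial (Fin 5) k ⧸ Ideal.span {f})))) := by
      rw [affineBlowup.support_idealSheaf]
      exact fun h => hy fun r hr => h hr
    haveI := (affineBlowup.isBlowup I).isIso_compl
    let U : (Spec (.of (MvPolynomial (Fin 5) k ⧸ Ideal.span {f}))).Opens :=
      ⟨((affineBlowup.idealSheaf I).support : Set (Spec (.of (MvPolynomial (Fin 5) k ⧸ Ideal.span {f}))))ᶜ,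
        (affineBlowup.idealSheaf I).support.isClosed.isOpen_compl⟩
    have hyU : (affineBlowup.π I).base y ∈ U := hsupp
    have hreg' : y ∈ Scheme.regularLocus (affineBlowup I) :=
      (mem_regularLocus_iff_of_isIso_morphismRestrict (affineBlowup.π I) U y hyU).mpr hreg
    rw [Scheme.mem_regularLocus] at hreg'
    haveI := hreg'
    haveI := FTemkinClosedPoints.charP_stalk_of_over 2
      (Spec.map (CommRingCat.ofHom (algebraMap k (MvPolynomial (Fin 5) k ⧸ Ideal.span {f})))) (affineBlowup.π I) y
    exact FTemkinClosedPoints.fullCl_of_isRegularLocalRing 2 _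

/-- **The support of the centre `Ĩ_{A′}` is the vertex** (the monomial ideal is `𝔪`-primary: pure powers of all five variables lie in `A′`).
[folklore; cite: StacksProject, Tag 0804] -/
theorem support_idealSheaf_tauRef (k : Type) [Field k] [CharP k 2] (f : MvPolynomial (Fin 5) k)
    (hf : f = X 4 ^ 2 + X 0 ^ 4 * X 4 + X 1 ^ 3 + X 2 ^ 3 + X 3 ^ 3)
    (v : Spec (.of (MvPolynomial (Fin 5) k ⧸ Ideal.span {f})))
    (hv : v.asIdeal = Ideal.span (Set.range fun j : Fin 5 => Ideal.Quotient.mk (Ideal.span {f}) (X j))) :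
    ((affineBlowup.idealSheaf (Ideal.span ((fun e : Fin 5 →₀ ℕ => Ideal.Quotient.mk (Ideal.span {f}) (monomial e (1 : k))) ''
        (P2d4CTauRefChar2Fan.A : Set (Fin 5 →₀ ℕ))))).support : Set (Spec (.of (MvPolynomial (Fin 5) k ⧸ Ideal.span {f})))) = {v} := by
  have hmax : v.asIdeal.IsMaximal := by
    rw [hv]; exact DoublePointFermatCubicGerm.isMaximal_origin k f (constantCoeff_f k f hf)
  rw [affineBlowup.support_idealSheaf]
  ext w
  change ((Ideal.span ((fun e : Fin 5 →₀ ℕ => Ideal.Quotient.mk (Ideal.span {f}) (monomial e (1 : k))) ''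
      (P2d4CTauRefChar2Fan.A : Set (Fin 5 →₀ ℕ))) : Ideal (MvPolynomial (Fin 5) k ⧸ Ideal.span {f})) :
      Set (MvPolynomial (Fin 5) k ⧸ Ideal.span {f})) ⊆ (w.asIdeal : Set (MvPolynomial (Fin 5) k ⧸ Ideal.span {f})) ↔ w = v
  rw [SetLike.coe_subset_coe,
    CICertificates.centre_le_iff (Ideal.span {f}) Finset.univ P2d4CTauRefChar2Fan.A P2d4CTauRefChar2Fan.hAJ P2d4CTauRefChar2Fan.hprim]
  constructor
  · intro h
    have hle : v.asIdeal ≤ w.asIdeal := by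
      rw [hv, Ideal.span_le]
      rintro _ ⟨j, rfl⟩
      exact h j (Finset.mem_univ j)
    exact PrimeSpectrum.ext (hmax.eq_of_le w.isPrime.ne_top hle).symm
  · rintro rfl j _
    rw [hv]
    exact Ideal.subset_span ⟨j, rfl⟩

/-- ★★ **EVERY BLOWING UP OF `X` ALONG `Ĩ_{A′}` IS FULL AT EVERY POINT** — the pinned-centre, universally-quantified form F4POS-2b consumes (any two blowings
up along the same centre are isomorphic over `X`, `IsBlowup.unique`; FULL moves along isomorphic stalks). [OURS · certificate instance; cite: GortzWedhorn2020, Prop. 13.92] -/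
theorem forall_isBlowup_tauRef_fullCl (k : Type) [Field k] [CharP k 2] (f : MvPolynomial (Fin 5) k)
    (hf : f = X 4 ^ 2 + X 0 ^ 4 * X 4 + X 1 ^ 3 + X 2 ^ 3 + X 3 ^ 3) :
    affineBlowup.idealSheaf (Ideal.span ((fun e : Fin 5 →₀ ℕ => Ideal.Quotient.mk (Ideal.span {f}) (monomial e (1 : k))) ''
        (P2d4CTauRefChar2Fan.A : Set (Fin 5 →₀ ℕ)))) ≠ ⊥ ∧
    ∀ (X' : Scheme.{0}) (π : X' ⟶ Spec (.of (MvPolynomial (Fin 5) k ⧸ Ideal.span {f}))),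
      IsBlowup π (affineBlowup.idealSheaf (Ideal.span ((fun e : Fin 5 →₀ ℕ => Ideal.Quotient.mk (Ideal.span {f}) (monomial e (1 : k))) ''
        (P2d4CTauRefChar2Fan.A : Set (Fin 5 →₀ ℕ))))) →
      ∀ x' : X', FullCl 2 (X'.presheaf.stalk x') := by
  haveI hfprime : (Ideal.span {f}).IsPrime := (Ideal.span_singleton_prime (prime_f k f hf).ne_zero).mpr (prime_f k f hf)
  haveI : IsDomain (MvPolynomial (Fin 5) k ⧸ Ideal.span {f}) := Ideal.Quotient.isDomain _
  have hIne : Ideal.span ((fun e : Fin 5 →₀ ℕ => Ideal.Quotient.mk (Ideal.span {f}) (monomial e (1 : k))) ''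
      (P2d4CTauRefChar2Fan.A : Set (Fin 5 →₀ ℕ))) ≠ ⊥ := by
    intro h0
    have hmem := P2d4CTauRefChar2Fan.hv k ![f] 0
    rw [LevelTwoBlockTranslate.range_vec_one] at hmem
    rw [h0] at hmem
    have hzero := (Submodule.mem_bot _).mp hmem
    -- `x̄^{m 0} ≠ 0` in the domain `k[X]/(f)` (no variable is zero)
    have hXne : ∀ j : Fin 5, Ideal.Quotient.mk (Ideal.span {f}) (X j) ≠ 0 := by
      intro j
      by_cases hj : j = 1
      · subst hj
        exact mk_X_ne_zero_of_eval k f hfprime 1 (Pi.single 2 1) (by simp) (by rw [hf]; simp)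
      · exact mk_X_ne_zero_of_eval k f hfprime j (Pi.single 1 1) (Pi.single_eq_of_ne hj _) (by rw [hf]; simp)
    apply (show Ideal.Quotient.mk (Ideal.span {f}) (monomial (P2d4CTauRefChar2Fan.m 0) (1 : k)) ≠ 0 from ?_) hzero
    rw [monomial_eq, C_1, one_mul, Finsupp.prod, map_prod]
    exact Finset.prod_ne_zero_iff.mpr fun j _ => by rw [map_pow]; exact pow_ne_zero _ (hXne j)
  haveI := affineBlowup.isIntegral hIne
  refine ⟨RegularBlowupModelDim2.ne_bot_of_isBlowup (affineBlowup.isBlowup _), fun X' π hπ x' => ?_⟩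
  obtain ⟨e, -, -⟩ := (affineBlowup.isBlowup _).unique hπ
  exact FTemkinClosedPoints.fullCl_of_isIso_stalkMap' 2 e.inv x' (affineBlowup_tauRef_fullCl k f hf (e.inv.base x'))

end Summit.ResolutionOfSingularities.ResolutionOfSingularities.Theorems.FInjectiveMacaulayfication.P2d4CTauRefBlowupFull

end
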